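import Summits.ABC.ABC.Theses.IneffectiveSubspace
import Literature.NumberTheory.DiophantineGeometry.AbcQualityProofs

/-!
# `PrimePowerRadical` (stmt-ABC-1648): the exponent `1 + ε` cannot be replaced by `1`

Negative support lemma for the crux `Summit.ABC.ABC.Theses.IneffectiveSubspace.PrimePowerRadical`
(cdisprove seat): for EVERY prime base `q` and every constant `M` some `k ≥ 1` has
`M · rad(1·(q^k−1)·q^k) < q^k` (Euler: `p² ∣ q^{φ(p²)} − 1`, Granville–Tucker's example inside the
family), hence the `ε`-free form of the crux is false and any proof must use `ε > 0`.
-/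

noncomputable section

namespace Summit.ABC.ABC.Theorems.PrimePowerRadical.Negative

open Literature.NumberTheory.DiophantineGeometry UniqueFactorizationMonoid

/-- `2 ≤ q^k` for `q ≥ 2`, `k ≥ 1`. [folklore] -/
theorem two_le_pow {q k : ℕ} (hq : 2 ≤ q) (hk : 1 ≤ k) : 2 ≤ q ^ k :=
  le_trans hq (by simpa using Nat.pow_le_pow_right (by omega : 0 < q) hk)

/-- `rad(1 · (q^k − 1) · q^k) = rad(q^k − 1) · q` for prime `q` and `k ≥ 1`. [folklore] -/
theorem rad_family_eq {q k : ℕ} (hq : q.Prime) (hk : 1 ≤ k) :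
    rad 1 (q ^ k - 1) (q ^ k) = radical (q ^ k - 1) * q := by
  have h2 := two_le_pow hq.two_le hk
  have hcop : Nat.Coprime (q ^ k - 1) (q ^ k) :=
    (Nat.coprime_self_sub_left (by omega : 1 ≤ q ^ k)).mpr (Nat.coprime_one_left _)
  rw [rad_def, one_mul, radical_mul (Nat.coprime_iff_isRelPrime.mp hcop),
    radical_pow _ (by omega : k ≠ 0), radical_eq_self_of_prime hq]

/-- If `p² ∣ b` with `b > 0` and `p` prime then `radical b · p ≤ b`. [folklore] -/
theorem radical_mul_le_of_sq_dvd {p b : ℕ} (hp : p.Prime) (hb : 0 < b) (hpb : p ^ 2 ∣ b) :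
    radical b * p ≤ b := by
  obtain ⟨m, hm⟩ := hpb
  have hdvd : radical b * p ∣ b := by
    have h1 : radical b ∣ p * radical m := by
      rw [hm]
      calc radical (p ^ 2 * m) ∣ radical (p ^ 2) * radical m := radical_mul_dvd
        _ = p * radical m := by rw [radical_pow _ two_ne_zero, radical_eq_self_of_prime hp]
    calc radical b * p ∣ p * radical m * p := mul_dvd_mul_right h1 p
      _ ∣ p * m * p := mul_dvd_mul_right (mul_dvd_mul_left p radical_dvd_self) p
      _ = b := by rw [hm]; ring
  exact Nat.le_of_dvd hb hdvd

/-- Euler: for distinct primes `p`, `q`, `p² ∣ q^{φ(p²)} − 1`. [folklore] -/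
theorem sq_dvd_pow_totient_sub_one {p q : ℕ} (hp : p.Prime) (hq : q.Prime) (hpq : p ≠ q) :
    p ^ 2 ∣ q ^ Nat.totient (p ^ 2) - 1 := by
  have hcop : Nat.Coprime q (p ^ 2) :=
    ((Nat.coprime_primes hq hp).mpr hpq.symm).pow_right 2
  have hmod : q ^ Nat.totient (p ^ 2) ≡ 1 [MOD p ^ 2] := Nat.ModEq.pow_totient hcop
  exact (Nat.modEq_iff_dvd' (Nat.one_le_pow _ _ hq.pos)).mp hmod.symm

/-- **The excess `q^k / rad` is unbounded along the family `(1, q^k − 1, q^k)`, for every prime `q`.**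
[cite: GranvilleTucker2002, p. 1227] -/
theorem exists_rad_family_mul_lt (q : ℕ) (hq : q.Prime) (M : ℕ) :
    ∃ k : ℕ, 1 ≤ k ∧ M * rad 1 (q ^ k - 1) (q ^ k) < q ^ k := by
  obtain ⟨p, hp_ge, hp⟩ := Nat.exists_infinite_primes (M * q + q + 1)
  have hpq : p ≠ q := by
    rintro rfl
    have := hq.pos
    omega
  set k := Nat.totient (p ^ 2) with hk
  have hk1 : 1 ≤ k := Nat.totient_pos.mpr (pow_pos hp.pos 2)
  refine ⟨k, hk1, ?_⟩
  have h2 := two_le_pow hq.two_le hk1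
  have hb : 0 < q ^ k - 1 := by omega
  have hsq : p ^ 2 ∣ q ^ k - 1 := sq_dvd_pow_totient_sub_one hp hq hpq
  have hrad : radical (q ^ k - 1) * p ≤ q ^ k - 1 := radical_mul_le_of_sq_dvd hp hb hsq
  rw [rad_family_eq hq hk1]
  have hMq : M * q < p := by omega
  have key : M * (radical (q ^ k - 1) * q) * p < q ^ k * p := by
    calc M * (radical (q ^ k - 1) * q) * p = M * q * (radical (q ^ k - 1) * p) := by ring
      _ ≤ M * q * (q ^ k - 1) := Nat.mul_le_mul_left _ hrad
      _ < p * (q ^ k - 1) := Nat.mul_lt_mul_of_pos_right hMq hb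
      _ ≤ p * q ^ k := Nat.mul_le_mul_left _ (Nat.sub_le _ _)
      _ = q ^ k * p := mul_comm _ _
  exact Nat.lt_of_mul_lt_mul_right key

/-- **No constant works at exponent `1`, for any prime base `q`.** [cite: GranvilleTucker2002, p. 1227] -/
theorem not_exponent_one (q : ℕ) (hq : q.Prime) :
    ¬ ∃ C : ℝ, ∀ k : ℕ, 1 ≤ k →
      ((q ^ k : ℕ) : ℝ) < C * ((rad 1 (q ^ k - 1) (q ^ k) : ℕ) : ℝ) := by
  rintro ⟨C, hC⟩
  obtain ⟨k, hk1, hlt⟩ := exists_rad_family_mul_lt q hq ⌈C⌉₊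
  have h := hC k hk1
  have hR : (0 : ℝ) ≤ ((rad 1 (q ^ k - 1) (q ^ k) : ℕ) : ℝ) := Nat.cast_nonneg _
  have hlt' : ((⌈C⌉₊ : ℕ) : ℝ) * ((rad 1 (q ^ k - 1) (q ^ k) : ℕ) : ℝ) < ((q ^ k : ℕ) : ℝ) := by
    exact_mod_cast hlt
  have hCle : C * ((rad 1 (q ^ k - 1) (q ^ k) : ℕ) : ℝ)
      ≤ ((⌈C⌉₊ : ℕ) : ℝ) * ((rad 1 (q ^ k - 1) (q ^ k) : ℕ) : ℝ) :=
    mul_le_mul_of_nonneg_right (Nat.le_ceil C) hR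
  linarith

/-- **Any proof of `PrimePowerRadical` must use `ε > 0`**: the crux with the exponent `1 + ε` replaced
by `1` ("the powerful part of `q^k − 1` is bounded for each prime `q`") is false — at every prime base.
[cite: GranvilleTucker2002, p. 1227] -/
theorem primePowerRadical_false_without_eps :
    ¬ ∀ q : ℕ, q.Prime → ∃ C : ℝ, 0 < C ∧ ∀ k : ℕ, 1 ≤ k →
      ((q ^ k : ℕ) : ℝ) < C * ((rad 1 (q ^ k - 1) (q ^ k) : ℕ) : ℝ) := fun h => by
  obtain ⟨C, -, hC⟩ := h 2 Nat.prime_two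
  exact not_exponent_one 2 Nat.prime_two ⟨C, hC⟩

end Summit.ABC.ABC.Theorems.PrimePowerRadical.Negative

end
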